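import Literature.MathematicalPhysics.QuantumFieldTheory.Balaban1983to89.B6IndexBondLayersKLevelV1
import Literature.MathematicalPhysics.QuantumFieldTheory.Balaban1983to89.B9Eq3132CoerciveVariational

/-!
# `Balaban1983to89.B9Eq3132TentOperator` — T. Bałaban, *Propagators and renormalization transformations for lattice gauge theories. II*, Commun. Math. Phys. **96**
# (1984) 223–250 [Balaban1984PropagatorsII], (2.147) p. 249 with [Balaban1985BackgroundPropagators] (3.13) p. 393, (3.132) p. 422: THE EXPLICIT TEST OPERATOR OF
# THE ROW-26 COERCIVITY AT def-Y's LETTERS — tents on the ε-layers of the base blocks, transported by def-Y's OWN taxicab transporters — and the EXACT expansion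
# `Re tr⟨Q(U)(T_θΨ), Λ⁻¹Ψ⟩ = ‖Ψ‖² + (cross terms)`, the cross terms bounded by the flat weights `e(y₂, y) = Σ_f q_{y₂}(f)θ_y(f)` (the transporters are Frobenius isometries)

statement-level skeleton of published theorems with citation tags; proofs where landed; nothing here is a claim about the Yang–Mills mass gap

THE PRINT.  [4] p. 249 (2.147) *«⟨λ, QGQ*λ⟩ ≥ γ₀ Σ_{y∈𝔅} Λ_y²|λ(y)|²»* and its variational mechanism (tree: `QGQInverse` §5, `B9Eq3132CoerciveVariational`); [B9] p. 393 (3.13) (the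
covariant average `Q(U)` with transporters — def-Y's `QY parB U = trLiftY qK (qT parB U)`: `(Q(U)A)(y) = Σ_f q_y(f)·R(τ_U(y,f))A(f)`).

WHY THIS FILE (dag-n06-i gen 13, N06 bundle F4, row 26).  `B9Eq3132CoerciveVariational.hcoA_of_testFamily` wants a test family `T x U` with (P′2)
`(1−ϑ)‖Ψ‖² ≤ Re tr⟨Q(U)(TΨ), Λ⁻¹Ψ⟩`.  THE TENTS: `(T_θΨ)(f) := Σ_y θ_y(f)·R(τ_U(y,f))⁻¹(Λ_yΨ(y))` for an admissible profile family `θ` (`B6IndexBondLayersKLevelV1.ProfileOK`: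
`θ_y ≥ 0` on the ε-layer of the base block of `y`, `Σ_f q_y(f)θ_y(f) = 1`).  Since the tent of `y` is transported back by the SAME transporter `τ_U(y,f)` that `Q(U)` applies,
the diagonal of `Q(U)T_θ` is EXACTLY the identity (no holonomy), and the off-diagonal terms are controlled by the flat weights alone (`R(·)` by a unitary is a Frobenius
isometry): THIS FILE proves `Re tr⟨Q(U)(T_θΨ), Λ⁻¹Ψ⟩ ≥ ‖Ψ‖² − Σ_{y₂ ≠ y} Λ_{y₂}⁻¹Λ_y·e(y₂,y)·‖Ψ(y₂)‖_F‖Ψ(y)‖_F`; the sequel bounds the flat matrix `e` (columns: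
`B6IndexBondLayersKLevelV1`; rows: the count of tents an index bond sees) and closes (P′2) by Schur.

WHAT IS PROVED (sorry-free).
* §1 Frobenius size of one matrix through n06-j's trace coordinates: `fro X := √(Re tr(XᴴX))`, `re_trace_le_fro_mul_fro` (Cauchy–Schwarz), `fro_R` (unitary conjugation is an
  isometry), `fro_smul`, `trIP_one_eq_sum_fro_sq`.
* §2 `tentOp θ U Ψ`, ★ `QY_tentOp_apply` (`(Q(U)T_θΨ)(y₂) = Σ_y Σ_f (q_{y₂}(f)θ_y(f))·R(τ(y₂,f))R(τ(y,f))⁻¹(Λ_yΨ(y))`), ★★ `diag_tentOp` (the `y = y₂` part IS `Λ_{y₂}Ψ(y₂)`),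
  `eWt` (the flat matrix `e(y₂,y)`), `eWt_nonneg`.
* §3 ★★★ `trIP_QY_tentOp_ge` — `Re tr⟨Q(U)(T_θΨ), Λ⁻¹Ψ⟩ ≥ Σ_y ‖Ψ(y)‖²_F − Σ_{y₂} Σ_{y ≠ y₂} Λ_{y₂}⁻¹Λ_y e(y₂,y) ‖Ψ(y)‖_F ‖Ψ(y₂)‖_F` at every `SU(N)`-valued `U`.

HONEST SCOPE.  Exact finite-dimensional algebra over def-Y's letters and r03's weights; no estimate of [B9]; count-neutral; NOT a node discharge.  Cell `pub-ymgap` (HUMAN RULING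
D-0062), Track A node N06 [B9], seat `pub-ymgap-dag-n06-i` (gen 13), 2026-08-27; a NEW file.
-/

noncomputable section

namespace Literature.MathematicalPhysics.QuantumFieldTheory.Balaban1983to89.B9Eq3132TentOperator

open Node00
open B6KLevelCensusIndexV1 (KIdx)
open B6Ineq2142KLevelV1 (qwt qwt_nonneg lvl)
open B9Thm311ReadingCoords (trIP trIP_eq_re_trace realify311 inner_realify311 norm_sq_realify311)
open B9Thm311DeltaPrimeSymm (conjTranspose_R)
open B9Eq39Adjoint (R R_mul R_R_inv R_smul trace_R)
open B7Prop2SpecialUnitary (specialUnitaryUnits specialUnitaryUnits_le_unitaryUnits)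
open B9Eq3132NuReading (lamY lamY_pos lamInvY)
open B9Eq3132Ineq2142Covariant (qK_apply)
open B6IndexBondLayersKLevelV1 (ProfileOK)
open scoped Matrix Matrix.Norms.L2Operator

variable {N : ℕ}

/-! ## §1 The Frobenius size of one matrix -/

section Fro

/-- `‖X‖_F := √(Re tr(XᴴX))` (print's `|X|² = tr X\*X`, p. 392). [cite: Balaban1985BackgroundPropagators, p.392 (X·Y = tr XY), dictionary] -/
def fro (X : Matrix (Fin N) (Fin N) ℂ) : ℝ := Real.sqrt ((Matrix.trace (Xᴴ * X)).re)

/-- `‖X‖_F ≥ 0`. [cite: Balaban1985BackgroundPropagators, p.392, bookkeeping] -/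
theorem fro_nonneg (X : Matrix (Fin N) (Fin N) ℂ) : 0 ≤ fro X := Real.sqrt_nonneg _

/-- the one-point trace pairing is `Re tr(XᴴY)`. [cite: Balaban1985BackgroundPropagators, p.393, bookkeeping] -/
theorem trIP_unit (X Y : Matrix (Fin N) (Fin N) ℂ) : trIP (fun _ : Unit => (1 : ℝ)) (fun _ => X) (fun _ => Y) = (Matrix.trace (Xᴴ * Y)).re := by
  rw [trIP_eq_re_trace, Fintype.sum_unique, one_mul]

/-- `‖X‖_F² = Re tr(XᴴX)` and the latter is `≥ 0`. [cite: Balaban1985BackgroundPropagators, p.392, bookkeeping] -/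
theorem fro_sq (X : Matrix (Fin N) (Fin N) ℂ) : fro X ^ 2 = (Matrix.trace (Xᴴ * X)).re := by
  have h : 0 ≤ (Matrix.trace (Xᴴ * X)).re := by
    rw [← trIP_unit, ← norm_sq_realify311 (w := fun _ : Unit => (1 : ℝ)) (hw := fun _ => one_pos)]; exact sq_nonneg _
  rw [fro, Real.sq_sqrt h]

/-- `‖X‖_F` IS the norm of n06-j's trace coordinates of the one-point function `X`. [cite: Balaban1985BackgroundPropagators, p.393, bookkeeping] -/
theorem fro_eq_norm (X : Matrix (Fin N) (Fin N) ℂ) : fro X = ‖realify311 (fun _ : Unit => (1 : ℝ)) (fun _ => one_pos) (fun _ => X)‖ := by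
  have h1 := fro_sq X
  have h2 := norm_sq_realify311 (w := fun _ : Unit => (1 : ℝ)) (hw := fun _ => one_pos) (fun _ => X)
  rw [trIP_unit] at h2
  nlinarith [fro_nonneg X, norm_nonneg (realify311 (fun _ : Unit => (1 : ℝ)) (fun _ => one_pos) (fun _ => X)), sq_nonneg (fro X - ‖realify311 (fun _ : Unit => (1 : ℝ)) (fun _ => one_pos) (fun _ => X)‖),
    sq_nonneg (fro X + ‖realify311 (fun _ : Unit => (1 : ℝ)) (fun _ => one_pos) (fun _ => X)‖)]

/-- **CAUCHY–SCHWARZ FOR THE TRACE PAIRING**: `Re tr(XᴴY) ≤ ‖X‖_F‖Y‖_F`. [cite: Balaban1985BackgroundPropagators, p.392, bookkeeping] -/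
theorem re_trace_le_fro_mul_fro (X Y : Matrix (Fin N) (Fin N) ℂ) : (Matrix.trace (Xᴴ * Y)).re ≤ fro X * fro Y := by
  rw [← trIP_unit, ← inner_realify311 (w := fun _ : Unit => (1 : ℝ)) (hw := fun _ => one_pos), fro_eq_norm, fro_eq_norm]
  exact (le_abs_self _).trans (abs_real_inner_le_norm _ _)

/-- **CONJUGATION BY A UNITARY IS A FROBENIUS ISOMETRY**: `‖R(V)X‖_F = ‖X‖_F`. [cite: Balaban1985BackgroundPropagators, (3.3) p.390 (R(U)X = UXU⁻¹), p.392] -/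
theorem fro_R (V : (Matrix (Fin N) (Fin N) ℂ)ˣ) (hV : (V : Matrix (Fin N) (Fin N) ℂ) ∈ unitary (Matrix (Fin N) (Fin N) ℂ)) (X : Matrix (Fin N) (Fin N) ℂ) :
    fro (R V X) = fro X := by
  unfold fro
  congr 2
  rw [conjTranspose_R V hV]
  have h : R V Xᴴ * R V X = R V (Xᴴ * X) := by simp only [R, mul_assoc, Units.inv_mul_cancel_left]
  rw [h]
  exact trace_R (Matrix.traceLinearMap (Fin N) ℂ ℂ) (fun a b => Matrix.trace_mul_comm a b) V _

/-- `‖r • X‖_F = |r|‖X‖_F`. [cite: Balaban1985BackgroundPropagators, p.392, bookkeeping] -/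
theorem fro_smul (r : ℝ) (X : Matrix (Fin N) (Fin N) ℂ) : fro (r • X) = |r| * fro X := by
  rw [fro_eq_norm, fro_eq_norm, ← Real.norm_eq_abs, ← norm_smul, ← map_smul]
  rfl

/-- `‖Ψ‖² = Σ_y ‖Ψ(y)‖_F²` for the weight-one pairing. [cite: Balaban1985BackgroundPropagators, p.393, bookkeeping] -/
theorem trIP_one_eq_sum_fro_sq {S : Type} [Fintype S] (Ψ : S → Matrix (Fin N) (Fin N) ℂ) : trIP (fun _ => (1 : ℝ)) Ψ Ψ = ∑ y, fro (Ψ y) ^ 2 := by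
  rw [trIP_eq_re_trace]
  exact Finset.sum_congr rfl fun y _ => by rw [one_mul, fro_sq]

/-- the pairing against a sum of transported terms, bounded termwise by Cauchy–Schwarz and the isometry. [cite: Balaban1985BackgroundPropagators, p.392, bookkeeping] -/
theorem re_trace_R_R_le (V W : (Matrix (Fin N) (Fin N) ℂ)ˣ) (hV : (V : Matrix (Fin N) (Fin N) ℂ) ∈ unitary (Matrix (Fin N) (Fin N) ℂ))
    (hW : (W : Matrix (Fin N) (Fin N) ℂ) ∈ unitary (Matrix (Fin N) (Fin N) ℂ)) (X Y : Matrix (Fin N) (Fin N) ℂ) :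
    -(fro X * fro Y) ≤ (Matrix.trace ((R V (R W X))ᴴ * Y)).re := by
  have h := re_trace_le_fro_mul_fro (-(R V (R W X))) Y
  rw [Matrix.conjTranspose_neg, Matrix.neg_mul, Matrix.trace_neg, Complex.neg_re] at h
  have e : fro (-(R V (R W X))) = fro X := by
    rw [show -(R V (R W X)) = ((-1 : ℝ) • R V (R W X)) by simp, fro_smul, fro_R V hV, fro_R W hW]; simp
  rw [e] at h
  linarith

end Fro

/-! ## §2 The tent operator, `Q(U)` on it, the exact diagonal -/

section Tent

open B6GlobalChartV1 (PV)

variable {d ℓ : ℕ} {hd : 1 ≤ d + 1} {hL : Odd (ℓ + 1) ∧ 1 < ℓ + 1} {b₀ b₁ : ℝ} (i : KIdx d ℓ hd hL b₀ b₁)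

/-- ★ **THE TENT OPERATOR** `(T_θΨ)(f) := Σ_y θ_y(f)·R(τ_U(y,f))⁻¹(Λ_yΨ(y))` — one tent per index bond, profile `θ_y`, amplitude `Λ_yΨ(y)`, transported back to the fine bond by the
inverse of def-Y's transporter `qT parBY U y f` of `Q(U)`. [cite: Balaban1984PropagatorsII, (2.147) p.249 (the test functions); Balaban1985BackgroundPropagators, (3.13) p.393] -/
def tentOp (θ : IBondY i → FBondY i → ℝ) (U : CfgY (Matrix (Fin N) (Fin N) ℂ) i) (Ψ : IBondY i → Matrix (Fin N) (Fin N) ℂ) :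
    FBondY i → Matrix (Fin N) (Fin N) ℂ :=
  fun f => ∑ y, θ y f • R (qT i (parBY i) U y f)⁻¹ (lamY i y • Ψ y)

/-- ★ **`Q(U)` ON THE TENTS**: `(Q(U)T_θΨ)(y₂) = Σ_y Σ_f (q_{y₂}(f)θ_y(f))·R(τ(y₂,f))R(τ(y,f))⁻¹(Λ_yΨ(y))`. [cite: Balaban1985BackgroundPropagators, (3.13) p.393; Balaban1984PropagatorsI, (1.18) p.20] -/
theorem QY_tentOp_apply (θ : IBondY i → FBondY i → ℝ) (U : CfgY (Matrix (Fin N) (Fin N) ℂ) i) (Ψ : IBondY i → Matrix (Fin N) (Fin N) ℂ) (y₂ : IBondY i) :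
    QY i (parBY i) U (tentOp i θ U Ψ) y₂ =
      ∑ y, ∑ f, (qwt i.hN i.D i.hk y₂ f * θ y f) • R (qT i (parBY i) U y₂ f) (R (qT i (parBY i) U y f)⁻¹ (lamY i y • Ψ y)) := by
  rw [QY, trLiftY_apply, Finset.sum_comm]
  refine Finset.sum_congr rfl fun f _ => ?_
  rw [qK_apply, tentOp]
  unfold R
  rw [Finset.mul_sum, Finset.sum_mul, Finset.smul_sum]
  refine Finset.sum_congr rfl fun y _ => ?_
  rw [mul_smul, Complex.coe_smul, Matrix.mul_smul, Matrix.smul_mul, smul_smul]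

/-- ★★ **THE DIAGONAL IS EXACT**: the `y = y₂` part of `(Q(U)T_θΨ)(y₂)` is `Λ_{y₂}Ψ(y₂)` — the transporters cancel (`R(τ)R(τ)⁻¹ = 1`) and the profile is normalised
(`Σ_f q_{y}(f)θ_y(f) = 1`). [cite: Balaban1984PropagatorsII, (2.147) p.249; Balaban1985BackgroundPropagators, (3.13) p.393] -/
theorem diag_tentOp {ε : ℝ} {θ : IBondY i → FBondY i → ℝ} (hθ : ProfileOK i ε θ) (U : CfgY (Matrix (Fin N) (Fin N) ℂ) i)
    (Ψ : IBondY i → Matrix (Fin N) (Fin N) ℂ) (y : IBondY i) :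
    ∑ f, (qwt i.hN i.D i.hk y f * θ y f) • R (qT i (parBY i) U y f) (R (qT i (parBY i) U y f)⁻¹ (lamY i y • Ψ y)) = lamY i y • Ψ y := by
  simp only [R_R_inv]
  rw [← Finset.sum_smul, hθ.norm y, one_smul]

/-- **THE FLAT MATRIX `e(y₂, y) := Σ_f q_{y₂}(f)θ_y(f)`** (the weight index bond `y₂` gives the tent of `y`). [cite: Balaban1984PropagatorsI, (1.18) p.20; Balaban1984PropagatorsII, (2.147) p.249] -/
def eWt (θ : IBondY i → FBondY i → ℝ) (y₂ y : IBondY i) : ℝ := ∑ f, qwt i.hN i.D i.hk y₂ f * θ y f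

/-- `e(y₂, y) ≥ 0`. [cite: Balaban1984PropagatorsI, (1.18) p.20, bookkeeping] -/
theorem eWt_nonneg {ε : ℝ} {θ : IBondY i → FBondY i → ℝ} (hθ : ProfileOK i ε θ) (y₂ y : IBondY i) : 0 ≤ eWt i θ y₂ y :=
  Finset.sum_nonneg fun f _ => mul_nonneg (qwt_nonneg _ _ _ _ _) (hθ.nonneg y f)

/-! ## §3 ★★★ The pairing against `Λ⁻¹Ψ`: exact diagonal, cross terms bounded by the flat matrix -/

/-- the transporters of `Q(U)` are unitary at an `SU(N)`-valued configuration. [cite: Balaban1985BackgroundPropagators, (3.13) p.393, (3.35) p.396, bookkeeping] -/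
theorem qT_unitary {U : CfgY (Matrix (Fin N) (Fin N) ℂ) i} (hU : ∀ μ x, U μ x ∈ specialUnitaryUnits (Fin N)) (y : IBondY i) (f : FBondY i) :
    ((qT i (parBY i) U y f : (Matrix (Fin N) (Fin N) ℂ)ˣ) : Matrix (Fin N) (Fin N) ℂ) ∈ unitary (Matrix (Fin N) (Fin N) ℂ) :=
  specialUnitaryUnits_le_unitaryUnits (parBY_mem i hU _ _)

/-- the inverse transporters are unitary too. [cite: Balaban1985BackgroundPropagators, (3.13) p.393, bookkeeping] -/
theorem qT_inv_unitary {U : CfgY (Matrix (Fin N) (Fin N) ℂ) i} (hU : ∀ μ x, U μ x ∈ specialUnitaryUnits (Fin N)) (y : IBondY i) (f : FBondY i) :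
    (((qT i (parBY i) U y f)⁻¹ : (Matrix (Fin N) (Fin N) ℂ)ˣ) : Matrix (Fin N) (Fin N) ℂ) ∈ unitary (Matrix (Fin N) (Fin N) ℂ) :=
  specialUnitaryUnits_le_unitaryUnits (Subgroup.inv_mem _ (parBY_mem i hU _ _))

/-- ★★★ **THE PAIRING OF `Q(U)T_θΨ` AGAINST `Λ⁻¹Ψ`**: exactly `‖Ψ‖²` from the diagonal, and cross terms at least
`−Σ_{y₂} Σ_{y ≠ y₂} Λ_{y₂}⁻¹Λ_y·e(y₂,y)·‖Ψ(y)‖_F‖Ψ(y₂)‖_F` (Cauchy–Schwarz and the Frobenius isometry of the transporters, termwise).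
[cite: Balaban1984PropagatorsII, (2.147) p.249; Balaban1985BackgroundPropagators, (3.13) p.393, (3.132) p.422] -/
theorem trIP_QY_tentOp_ge {ε : ℝ} {θ : IBondY i → FBondY i → ℝ} (hθ : ProfileOK i ε θ) {U : CfgY (Matrix (Fin N) (Fin N) ℂ) i}
    (hU : ∀ μ x, U μ x ∈ specialUnitaryUnits (Fin N)) (Ψ : IBondY i → Matrix (Fin N) (Fin N) ℂ) :
    ∑ y, fro (Ψ y) ^ 2 - ∑ y₂, ∑ y ∈ Finset.univ.erase y₂, lamInvY i y₂ * lamY i y * eWt i θ y₂ y * (fro (Ψ y) * fro (Ψ y₂)) ≤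
      trIP (fun _ => (1 : ℝ)) (QY i (parBY i) U (tentOp i θ U Ψ)) (fun y => lamInvY i y • Ψ y) := by
  classical
  rw [trIP_eq_re_trace, ← Finset.sum_sub_distrib]
  refine Finset.sum_le_sum fun y₂ _ => ?_
  rw [one_mul, QY_tentOp_apply, ← Finset.add_sum_erase _ _ (Finset.mem_univ y₂), diag_tentOp i hθ U Ψ y₂]
  -- the pairing of the split sum
  have hΛ := lamY_pos i y₂
  rw [Matrix.conjTranspose_add, Matrix.add_mul, Matrix.trace_add, Complex.add_re]
  -- diagonal: `Re tr((Λ Ψ)ᴴ (Λ⁻¹ Ψ)) = ‖Ψ(y₂)‖²`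
  have hdiag : (Matrix.trace ((lamY i y₂ • Ψ y₂)ᴴ * (lamInvY i y₂ • Ψ y₂))).re = fro (Ψ y₂) ^ 2 := by
    rw [Matrix.conjTranspose_smul, Matrix.smul_mul, Matrix.mul_smul, smul_smul, Matrix.trace_smul, star_trivial, lamInvY, mul_inv_cancel₀ hΛ.ne',
      one_smul, fro_sq]
  rw [hdiag, sub_eq_add_neg]
  refine add_le_add le_rfl ?_
  -- cross terms: `Re tr((Σ_y Σ_f c • RR(ΛΨ y))ᴴ (Λ⁻¹Ψ y₂)) = Σ_y Σ_f c Λ_y Λ_{y₂}⁻¹ Re tr((RRΨ y)ᴴ Ψ y₂) ≥ −Σ …`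
  rw [Matrix.conjTranspose_sum, Finset.sum_mul, Matrix.trace_sum, Complex.re_sum, ← Finset.sum_neg_distrib]
  refine Finset.sum_le_sum fun y hy => ?_
  rw [Matrix.conjTranspose_sum, Finset.sum_mul, Matrix.trace_sum, Complex.re_sum, eWt, Finset.mul_sum, Finset.sum_mul, ← Finset.sum_neg_distrib]
  refine Finset.sum_le_sum fun f _ => ?_
  have hc : 0 ≤ qwt i.hN i.D i.hk y₂ f * θ y f := mul_nonneg (qwt_nonneg _ _ _ _ _) (hθ.nonneg y f)
  -- pull the real scalars out of the trace
  have hre : (Matrix.trace (((qwt i.hN i.D i.hk y₂ f * θ y f) • R (qT i (parBY i) U y₂ f) (R (qT i (parBY i) U y f)⁻¹ (lamY i y • Ψ y)))ᴴ *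
        (lamInvY i y₂ • Ψ y₂))).re =
      qwt i.hN i.D i.hk y₂ f * θ y f * (lamY i y * lamInvY i y₂) *
        (Matrix.trace ((R (qT i (parBY i) U y₂ f) (R (qT i (parBY i) U y f)⁻¹ (Ψ y)))ᴴ * Ψ y₂)).re := by
    rw [R_smul, R_smul, Matrix.conjTranspose_smul, Matrix.conjTranspose_smul, star_trivial, star_trivial, Matrix.smul_mul, Matrix.smul_mul, Matrix.mul_smul,
      Matrix.trace_smul, Matrix.trace_smul, Matrix.trace_smul, Complex.smul_re, Complex.smul_re, Complex.smul_re, smul_eq_mul, smul_eq_mul, smul_eq_mul]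
    ring
  rw [hre]
  have hcs := re_trace_R_R_le (qT i (parBY i) U y₂ f) (qT i (parBY i) U y f)⁻¹ (qT_unitary i hU y₂ f) (qT_inv_unitary i hU y f) (Ψ y) (Ψ y₂)
  have hpos : 0 ≤ qwt i.hN i.D i.hk y₂ f * θ y f * (lamY i y * lamInvY i y₂) :=
    mul_nonneg hc (mul_nonneg (lamY_pos i y).le (B9Eq3132NuReading.lamInvY_pos i y₂).le)
  calc -(lamInvY i y₂ * lamY i y * (qwt i.hN i.D i.hk y₂ f * θ y f) * (fro (Ψ y) * fro (Ψ y₂)))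
      = qwt i.hN i.D i.hk y₂ f * θ y f * (lamY i y * lamInvY i y₂) * (-(fro (Ψ y) * fro (Ψ y₂))) := by ring
    _ ≤ qwt i.hN i.D i.hk y₂ f * θ y f * (lamY i y * lamInvY i y₂) *
        (Matrix.trace ((R (qT i (parBY i) U y₂ f) (R (qT i (parBY i) U y f)⁻¹ (Ψ y)))ᴴ * Ψ y₂)).re := mul_le_mul_of_nonneg_left hcs hpos

end Tent

end Literature.MathematicalPhysics.QuantumFieldTheory.Balaban1983to89.B9Eq3132TentOperator

end
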